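import Literature.AlgebraicGeometry.Resolution.SmoothFactorizationsBaseInduction
import Literature.AlgebraicGeometry.Resolution.SmoothFactorizationsProduct
import Mathlib.RingTheory.Artinian.Module
import Mathlib.RingTheory.HopkinsLevitzki
import Mathlib.RingTheory.LocalProperties.Reduced
import Mathlib.RingTheory.Ideal.MinimalPrime.Noetherian
import Mathlib.RingTheory.Ideal.MinimalPrime.Localization
import Mathlib.RingTheory.KrullDimension.Basic
import HarnessLib

/-!
# PT for the total ring of fractions of a reduced base (the step `Q = K₁ × … × K_n` of Stacks 07F5)

Topic: `Literature/AlgebraicGeometry/Resolution`. Groundwork for the proof of the named fact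
`Stacks07F5_reduceToField` (`NeronPopescuSteps.lean`). After the Noetherian induction and the
reduction to a reduced base, the printed proof of Stacks, Lemma 07F5 continues:

> Let `S ⊂ R` be the set of nonzerodivisors and consider the total ring of fractions
> `Q = S⁻¹R` of `R`. We know that `Q = K₁ × … × K_n` is a product of fields, see Algebra,
> Lemmas 02LX and 00EW. By Lemma 07F3 and our assumption PT holds for the ring map
> `S⁻¹R → S⁻¹Λ`.

This file PROVES this step:

* `exists_mem_minimalPrimes_of_not_mem_nonZeroDivisors` — in a reduced ring a zero divisor
  lies in a minimal prime (Algebra 00EW: the zero divisors of a reduced ring are the union of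
  its minimal primes);
* `mem_minimalPrimes_of_disjoint_nonZeroDivisors` — hence, in a reduced Noetherian ring, a
  prime consisting of zero divisors is a minimal prime (prime avoidance over the finitely many
  minimal primes);
* `isArtinianRing_of_isFractionRing_of_isReduced` — so the total ring of fractions `Q` of a
  reduced Noetherian ring has all its primes maximal, i.e. is Artinian (and reduced), which is
  the content of Algebra 02LX: `Q ≅ ∏_𝔪 Q/𝔪` is a finite product of fields
  (Mathlib's `IsArtinianRing.equivPi`);
* `hasSmoothFactorizations_isFractionRing_of_field` — **the step of 07F5**: if PT holds for
  every regular `k → Λ'` with `k` a field and `Λ'` Noetherian, then for a regular `R → Λ` of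
  Noetherian rings with `R` reduced, PT holds for `S⁻¹R → S⁻¹Λ` (any localisations at the
  non-zero-divisors `S` of `R`). Proof: `S⁻¹R → S⁻¹Λ` is regular
  (`IsRegularHom.isLocalization`), hence so is each `Q/𝔪 → S⁻¹Λ/𝔪S⁻¹Λ`
  (`IsRegularHom.quotient`, Stacks 07C1) with `Q/𝔪` a field, so PT holds for these by
  assumption, and for `Q → S⁻¹Λ` by 07F3 in Chinese-remainder form
  (`HasSmoothFactorizations.of_pairwise_isCoprime`).

No new notions, no named facts.

## Sources

* The Stacks Project, *Smoothing Ring Maps* (Tag 07BW), proof of Lemma 07F5; *Algebra*,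
  Lemma 00EW (minimal primes and zero divisors of a reduced ring), Lemma 02LX (total ring of
  fractions of a reduced ring with finitely many minimal primes), Lemma 00DT. [StacksProject]
-/

noncomputable section

open TensorProduct nonZeroDivisors

namespace Literature.AlgebraicGeometry.Resolution

universe u

/-! ## Zero divisors and minimal primes of a reduced Noetherian ring (Algebra 00EW, 02LX) -/

section Reduced

variable {R : Type u} [CommRing R]

/-- **Algebra 00EW** (part): in a reduced ring every zero divisor lies in a minimal prime
(if `xy = 0` with `y ≠ 0`, then `y ∉ ⋂_{𝔮 minimal} 𝔮 = nil(R) = 0`, so `y ∉ 𝔮` for some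
minimal `𝔮`, and `x ∈ 𝔮`). [cite: StacksProject, Tag 00EW] -/
theorem exists_mem_minimalPrimes_of_not_mem_nonZeroDivisors [IsReduced R] {x : R}
    (hx : x ∉ nonZeroDivisors R) : ∃ q ∈ minimalPrimes R, x ∈ q := by
  rw [mem_nonZeroDivisors_iff_right] at hx
  push Not at hx
  obtain ⟨y, hyx, hy⟩ := hx
  by_contra hcon
  push Not at hcon
  -- then `y` lies in every minimal prime, hence is nilpotent, hence zero
  have hy' : y ∈ sInf (minimalPrimes R) := by
    refine Ideal.mem_sInf.mpr fun q hq => ?_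
    haveI : q.IsPrime := hq.1.1
    rcases (‹q.IsPrime›).mem_or_mem (show y * x ∈ q by rw [hyx]; exact q.zero_mem) with h | h
    · exact h
    · exact absurd h (hcon q hq)
  rw [minimalPrimes, Ideal.sInf_minimalPrimes] at hy'
  obtain ⟨n, hn⟩ := hy'
  exact hy (IsNilpotent.eq_zero ⟨n, (Ideal.mem_bot).mp hn⟩)

/-- In a reduced Noetherian ring, a prime ideal consisting of zero divisors is a minimal prime
(Algebra 00EW with prime avoidance over the finitely many minimal primes; this is why the
primes of the total ring of fractions are the minimal primes, Algebra 02LX).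
[cite: StacksProject, Tag 02LX] -/
theorem mem_minimalPrimes_of_disjoint_nonZeroDivisors [IsReduced R] [IsNoetherianRing R]
    (p : Ideal R) [hp : p.IsPrime] (hd : Disjoint ((nonZeroDivisors R : Submonoid R) : Set R) p) :
    p ∈ minimalPrimes R := by
  have hfin : (minimalPrimes R).Finite := minimalPrimes.finite_of_isNoetherianRing R
  have hsub : (p : Set R) ⊆ ⋃ q ∈ minimalPrimes R, ((id q : Ideal R) : Set R) := by
    intro x hx
    have hx0 : x ∉ nonZeroDivisors R := fun h0 => Set.disjoint_left.mp hd h0 hx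
    obtain ⟨q, hq, hxq⟩ := exists_mem_minimalPrimes_of_not_mem_nonZeroDivisors hx0
    exact Set.mem_biUnion hq hxq
  obtain ⟨q, hq, hpq⟩ := (Ideal.subset_union_prime_finite hfin (f := id) ⊥ ⊥
    (fun q hq _ _ => hq.1.1)).1 hsub
  have hqp : q ≤ p := hq.2 ⟨hp, bot_le⟩ hpq
  rwa [show p = q from le_antisymm hpq hqp]

/-- **Algebra 02LX** (the total ring of fractions of a reduced Noetherian ring is a finite
product of fields), in the form: every prime of `Q = S⁻¹R` (`S` the non-zero-divisors) is
maximal, so `Q` is a reduced Artinian ring — whence `Q ≅ ∏_𝔪 Q/𝔪` by Mathlib's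
`IsArtinianRing.equivPi`. (The primes of `Q` are the primes of `R` inside the zero divisors,
i.e. the minimal primes, which are pairwise incomparable.) [cite: StacksProject, Tag 02LX] -/
theorem isArtinianRing_of_isFractionRing_of_isReduced [IsReduced R] [IsNoetherianRing R]
    (Q : Type u) [CommRing Q] [Algebra R Q] [IsFractionRing R Q] : IsArtinianRing Q := by
  haveI : IsNoetherianRing Q := IsLocalization.isNoetherianRing (nonZeroDivisors R) Q inferInstance
  rw [isArtinianRing_iff_isNoetherianRing_krullDimLE_zero]
  refine ⟨inferInstance, Ring.krullDimLE_zero_iff.mpr fun P hP => ?_⟩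
  obtain ⟨M, hM, hPM⟩ := Ideal.exists_le_maximal P hP.ne_top
  suffices hPM' : P = M by rw [hPM']; exact hM
  have hP' := (IsLocalization.isPrime_iff_isPrime_disjoint (nonZeroDivisors R) Q P).mp hP
  have hM' := (IsLocalization.isPrime_iff_isPrime_disjoint (nonZeroDivisors R) Q M).mp hM.isPrime
  haveI := hM'.1
  haveI := hP'.1
  have hmin : M.under R ∈ minimalPrimes R :=
    mem_minimalPrimes_of_disjoint_nonZeroDivisors (M.under R) hM'.2
  have hle : P.under R ≤ M.under R := Ideal.comap_mono hPM
  have hge : M.under R ≤ P.under R := hmin.2 ⟨hP'.1, bot_le⟩ hle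
  rw [← IsLocalization.map_under (nonZeroDivisors R) Q P,
    ← IsLocalization.map_under (nonZeroDivisors R) Q M, le_antisymm hle hge]

end Reduced

/-! ## PT for `S⁻¹R → S⁻¹Λ` from PT over fields -/

section FractionRing

/-- **The step "`Q = K₁ × … × K_n`, hence PT holds for `S⁻¹R → S⁻¹Λ`" of the proof of Stacks
07F5.** Assume PT for every regular `k → Λ'` with `k` a field and `Λ'` Noetherian. Let
`R → Λ` be a regular homomorphism of Noetherian rings with `R` reduced, `S` the
non-zero-divisors of `R`, and `Q = S⁻¹R`, `Λ' = S⁻¹Λ` any localisations. Then PT holds for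
`Q → Λ'`: `Q` is reduced Artinian (Algebra 02LX), `Q → Λ'` is regular, hence so is each
`Q/𝔪 → Λ'/𝔪Λ'` (07C1) with `Q/𝔪` a field, and 07F3 (`Q = ∏ Q/𝔪`, `Λ' = ∏ Λ'/𝔪Λ'`)
assembles PT for `Q → Λ'`. [cite: StacksProject, Tag 07F5 (proof)] -/
theorem hasSmoothFactorizations_isFractionRing_of_field
    (hk : ∀ (k Λ₀ : Type u) [Field k] [CommRing Λ₀] [Algebra k Λ₀],
      IsNoetherianRing Λ₀ → IsRegularHom k Λ₀ → HasSmoothFactorizations k Λ₀)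
    {R Λ : Type u} [CommRing R] [CommRing Λ] [Algebra R Λ] [IsReduced R] [IsNoetherianRing R]
    [IsNoetherianRing Λ] (h : IsRegularHom R Λ)
    (Q Λ' : Type u) [CommRing Q] [Algebra R Q] [IsFractionRing R Q] [CommRing Λ']
    [Algebra Λ Λ'] [Algebra R Λ'] [IsScalarTower R Λ Λ']
    [IsLocalization (Algebra.algebraMapSubmonoid Λ (nonZeroDivisors R)) Λ'] [Algebra Q Λ']
    [IsScalarTower R Q Λ'] : HasSmoothFactorizations Q Λ' := by
  have hQ : IsRegularHom Q Λ' := h.isLocalization (nonZeroDivisors R) Q Λ'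
  haveI : IsNoetherianRing Q := IsLocalization.isNoetherianRing (nonZeroDivisors R) Q inferInstance
  haveI : IsNoetherianRing Λ' :=
    IsLocalization.isNoetherianRing (Algebra.algebraMapSubmonoid Λ (nonZeroDivisors R)) Λ'
      inferInstance
  haveI : IsReduced Q := isReduced_localizationPreserves (nonZeroDivisors R) Q inferInstance
  haveI : IsArtinianRing Q := isArtinianRing_of_isFractionRing_of_isReduced (R := R) Q
  refine HasSmoothFactorizations.of_pairwise_isCoprime (ι := MaximalSpectrum Q)
    (fun I => I.asIdeal) (fun I J hIJ => MaximalSpectrum.isCoprime_of_ne hIJ) ?_ fun I => ?_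
  · change iInf MaximalSpectrum.asIdeal = ⊥
    rw [← IsArtinianRing.nilradical_eq_iInf, nilradical_eq_zero, Ideal.zero_eq_bot]
  · haveI : I.asIdeal.IsMaximal := I.isMaximal
    letI : Field (Q ⧸ I.asIdeal) := Ideal.Quotient.field I.asIdeal
    exact hk (Q ⧸ I.asIdeal) (Λ' ⧸ I.asIdeal.map (algebraMap Q Λ')) inferInstance
      (hQ.quotient I.asIdeal)

end FractionRing

end Literature.AlgebraicGeometry.Resolution

end
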